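import Mathlib
import Summits.Ventures.PercRepro.TriangleCapRegularCellNine

/-!
# PercRepro — THE REGULAR CELL `t = 10 D` ON `11 + (s − t)` VERTICES, EXACTLY: `{bottom, bottom + 9, bottom + 16, bottom + 17, bottom + 18, bottom + 21} ∪ [bottom + 23, bottom + 45 D]`
(p3, gen 57; part 353)

At `ℓ = 10` the row excess `Σ_{rows} k (10 − k)` is `0`, `18` or at least `32` (parts 290–291), at most `90 D`, and NEVER
`38`, `40` or `44` (THE GAPS `{19, 20, 22}`, `no_nineteen_ten`, `no_twenty_ten`, `no_twentytwo_ten`): with `n_j` rows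
of size `j`, `Σ k (10 − k) = 9 (n₁ + n₉) + 16 (n₂ + n₈) + 21 (n₃ + n₇) + 24 (n₄ + n₆) + 25 n₅`, and every count
vector of those values has `Σ k ≢ 0 (mod 10)`.  The single-block values (rows of ten edges) are
`E₁(10) = {9, 16, 17, 21, 23, 24, 25, 27, 28, 29, 31, 32, 33, 35, 36, 37, 39, 40, …, 45}`; `18 = 9 + 9`, `26 = 9 + 17`,
`30 = 9 + 21`, `34 = 9 + 25`, `38 = 17 + 21` and every value `≥ 46` up to `90` needs two blocks (`blockTen`).  THEOREM
(`regular_cell_ten`, `10 ≤ D`, `t = 10 D`, `2 t ≤ s`): `j − bottomReg 10 D ∈ {0, 9, 16, 17, 18, 21} ∪ [23, 45 D]` — the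
excess set at `ℓ = 10` misses exactly `{1, …, 8, 10, …, 15, 19, 20, 22}` (the census mining/p3/g55/excess_sets.py,
`D = 2, 3, 4`).  Axioms: standard.
-/

namespace PercRepro

namespace TriangleCap

namespace C047

open Finset

/-- The entries of a list in `[1, 10]` give a sequence in `[1, 10]` below the length. -/
theorem getD_bounds_ten (L : List ℕ) (hL : ∀ x ∈ L, 1 ≤ x ∧ x ≤ 10) (i : ℕ) (hi : i < L.length) :
    1 ≤ L.getD i 0 ∧ L.getD i 0 ≤ 10 := by
  rw [List.getD_eq_getElem L 0 hi]
  exact hL _ (List.getElem_mem hi)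

/-- A sum of a function of the row sizes is the sum over the sizes `j ≤ 10` of `n_j · f(j)`. -/
theorem sum_rows_eq_sum_counts_ten (k : ℕ → ℕ) (N : ℕ) (hk : ∀ i, i < N → k i ≤ 10) (f : ℕ → ℕ) :
    ∑ i ∈ range N, f (k i) = ∑ j ∈ range 11, ((range N).filter (fun i => k i = j)).card * f j := by
  rw [← sum_fiberwise_of_maps_to (s := range N) (t := range 11) (g := k) (fun i hi => by
    rw [mem_range] at hi ⊢
    have := hk i hi
    omega)]
  apply sum_congr rfl
  intro j _
  rw [card_eq_sum_ones, sum_mul, one_mul]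
  apply sum_congr rfl
  intro i hi
  rw [mem_filter] at hi
  rw [hi.2]

/-- The row counts at `ℓ = 10`: `Σ k = Σ_j j n_j` and `Σ k (10 − k) = 9 (n₁ + n₉) + 16 (n₂ + n₈) + 21 (n₃ + n₇) + 24 (n₄ + n₆) + 25 n₅`. -/
theorem counts_ten (k : ℕ → ℕ) (N : ℕ) (hk : ∀ i, i < N → 1 ≤ k i ∧ k i ≤ 10) :
    ∑ i ∈ range N, k i = ((range N).filter (fun i => k i = 1)).card + 2 * ((range N).filter (fun i => k i = 2)).card +
      3 * ((range N).filter (fun i => k i = 3)).card + 4 * ((range N).filter (fun i => k i = 4)).card +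
      5 * ((range N).filter (fun i => k i = 5)).card + 6 * ((range N).filter (fun i => k i = 6)).card +
      7 * ((range N).filter (fun i => k i = 7)).card + 8 * ((range N).filter (fun i => k i = 8)).card +
      9 * ((range N).filter (fun i => k i = 9)).card + 10 * ((range N).filter (fun i => k i = 10)).card ∧
    ∑ i ∈ range N, k i * (10 - k i) = 9 * ((range N).filter (fun i => k i = 1)).card +
      16 * ((range N).filter (fun i => k i = 2)).card + 21 * ((range N).filter (fun i => k i = 3)).card +
      24 * ((range N).filter (fun i => k i = 4)).card + 25 * ((range N).filter (fun i => k i = 5)).card +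
      24 * ((range N).filter (fun i => k i = 6)).card + 21 * ((range N).filter (fun i => k i = 7)).card +
      16 * ((range N).filter (fun i => k i = 8)).card + 9 * ((range N).filter (fun i => k i = 9)).card := by
  have h1 := sum_rows_eq_sum_counts_ten k N (fun i hi => (hk i hi).2) (fun j => j)
  have h2 := sum_rows_eq_sum_counts_ten k N (fun i hi => (hk i hi).2) (fun j => j * (10 - j))
  simp only [sum_range_succ, sum_range_zero] at h1 h2
  norm_num at h1 h2
  constructor
  · rw [h1]; ring
  · rw [h2]; ring

/-- **THE GAP `19` AT `ℓ = 10`:** `Σ k (10 − k) ≠ 38` when `Σ k = 10 D`. -/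
theorem no_nineteen_ten (D : ℕ) (k : ℕ → ℕ) (N : ℕ) (hk : ∀ i, i < N → 1 ≤ k i ∧ k i ≤ 10)
    (hsum : ∑ i ∈ range N, k i = 10 * D) : ∑ i ∈ range N, k i * (10 - k i) ≠ 38 := by
  intro hv
  obtain ⟨h1, h2⟩ := counts_ten k N hk
  rw [h1] at hsum
  rw [h2] at hv
  set n1 := ((range N).filter (fun i => k i = 1)).card
  set n2 := ((range N).filter (fun i => k i = 2)).card
  set n3 := ((range N).filter (fun i => k i = 3)).card
  set n4 := ((range N).filter (fun i => k i = 4)).card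
  set n5 := ((range N).filter (fun i => k i = 5)).card
  set n6 := ((range N).filter (fun i => k i = 6)).card
  set n7 := ((range N).filter (fun i => k i = 7)).card
  set n8 := ((range N).filter (fun i => k i = 8)).card
  set n9 := ((range N).filter (fun i => k i = 9)).card
  set n10 := ((range N).filter (fun i => k i = 10)).card
  have hb5 : n5 ≤ 1 := by omega
  have hb4 : n4 ≤ 1 := by omega
  have hb6 : n6 ≤ 1 := by omega
  have hb3 : n3 ≤ 1 := by omega
  have hb7 : n7 ≤ 1 := by omega
  have hb2 : n2 ≤ 2 := by omega
  have hb8 : n8 ≤ 2 := by omega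
  interval_cases n5 <;> interval_cases n4 <;> interval_cases n6 <;> interval_cases n3 <;> interval_cases n7 <;> interval_cases n2 <;> interval_cases n8 <;> omega

/-- **THE GAP `20` AT `ℓ = 10`:** `Σ k (10 − k) ≠ 40` when `Σ k = 10 D`. -/
theorem no_twenty_ten (D : ℕ) (k : ℕ → ℕ) (N : ℕ) (hk : ∀ i, i < N → 1 ≤ k i ∧ k i ≤ 10)
    (hsum : ∑ i ∈ range N, k i = 10 * D) : ∑ i ∈ range N, k i * (10 - k i) ≠ 40 := by
  intro hv
  obtain ⟨h1, h2⟩ := counts_ten k N hk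
  rw [h1] at hsum
  rw [h2] at hv
  set n1 := ((range N).filter (fun i => k i = 1)).card
  set n2 := ((range N).filter (fun i => k i = 2)).card
  set n3 := ((range N).filter (fun i => k i = 3)).card
  set n4 := ((range N).filter (fun i => k i = 4)).card
  set n5 := ((range N).filter (fun i => k i = 5)).card
  set n6 := ((range N).filter (fun i => k i = 6)).card
  set n7 := ((range N).filter (fun i => k i = 7)).card
  set n8 := ((range N).filter (fun i => k i = 8)).card
  set n9 := ((range N).filter (fun i => k i = 9)).card
  set n10 := ((range N).filter (fun i => k i = 10)).card
  have hb5 : n5 ≤ 1 := by omega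
  have hb4 : n4 ≤ 1 := by omega
  have hb6 : n6 ≤ 1 := by omega
  have hb3 : n3 ≤ 1 := by omega
  have hb7 : n7 ≤ 1 := by omega
  have hb2 : n2 ≤ 2 := by omega
  have hb8 : n8 ≤ 2 := by omega
  interval_cases n5 <;> interval_cases n4 <;> interval_cases n6 <;> interval_cases n3 <;> interval_cases n7 <;> interval_cases n2 <;> interval_cases n8 <;> omega

/-- **THE GAP `22` AT `ℓ = 10`:** `Σ k (10 − k) ≠ 44` when `Σ k = 10 D`. -/
theorem no_twentytwo_ten (D : ℕ) (k : ℕ → ℕ) (N : ℕ) (hk : ∀ i, i < N → 1 ≤ k i ∧ k i ≤ 10)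
    (hsum : ∑ i ∈ range N, k i = 10 * D) : ∑ i ∈ range N, k i * (10 - k i) ≠ 44 := by
  intro hv
  obtain ⟨h1, h2⟩ := counts_ten k N hk
  rw [h1] at hsum
  rw [h2] at hv
  set n1 := ((range N).filter (fun i => k i = 1)).card
  set n2 := ((range N).filter (fun i => k i = 2)).card
  set n3 := ((range N).filter (fun i => k i = 3)).card
  set n4 := ((range N).filter (fun i => k i = 4)).card
  set n5 := ((range N).filter (fun i => k i = 5)).card
  set n6 := ((range N).filter (fun i => k i = 6)).card
  set n7 := ((range N).filter (fun i => k i = 7)).card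
  set n8 := ((range N).filter (fun i => k i = 8)).card
  set n9 := ((range N).filter (fun i => k i = 9)).card
  set n10 := ((range N).filter (fun i => k i = 10)).card
  have hb5 : n5 ≤ 1 := by omega
  have hb4 : n4 ≤ 1 := by omega
  have hb6 : n6 ≤ 1 := by omega
  have hb3 : n3 ≤ 2 := by omega
  have hb7 : n7 ≤ 2 := by omega
  have hb2 : n2 ≤ 2 := by omega
  have hb8 : n8 ≤ 2 := by omega
  interval_cases n5 <;> interval_cases n4 <;> interval_cases n6 <;> interval_cases n3 <;> interval_cases n7 <;> interval_cases n2 <;> interval_cases n8 <;> omega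

/-- The block of excess `e ∈ {9, 16, 17, 18, 21} ∪ [23, 90]` (rows of ten or twenty edges): its sizes. -/
def blockTen (e : ℕ) : List ℕ :=
  if e = 9 then [9, 1]
  else if e = 16 then [8, 2]
  else if e = 17 then [8, 1, 1]
  else if e = 18 then [9, 9, 1, 1]
  else if e = 21 then [7, 3]
  else if e = 23 then [7, 2, 1]
  else if e = 24 then [6, 4]
  else if e = 25 then [5, 5]
  else if e = 26 then [9, 8, 1, 1, 1]
  else if e = 27 then [6, 3, 1]
  else if e = 28 then [6, 2, 2]
  else if e = 29 then [5, 4, 1]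
  else if e = 30 then [9, 7, 3, 1]
  else if e = 31 then [5, 3, 2]
  else if e = 32 then [4, 4, 2]
  else if e = 33 then [4, 3, 3]
  else if e = 34 then [9, 5, 5, 1]
  else if e = 35 then [4, 3, 2, 1]
  else if e = 36 then [3, 3, 3, 1]
  else if e = 37 then [3, 3, 2, 2]
  else if e = 38 then [7, 7, 5, 1]
  else if e = 39 then [7, 6, 6, 1]
  else if e = 40 then [8, 6, 4, 2]
  else if e = 41 then [7, 7, 4, 2]
  else if e = 42 then [7, 7, 3, 3]
  else if e = 43 then [7, 6, 5, 2]
  else if e = 44 then [6, 6, 6, 2]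
  else if e = 45 then [7, 6, 4, 3]
  else if e = 46 then [7, 5, 5, 3]
  else if e = 47 then [6, 6, 5, 3]
  else if e = 48 then [6, 6, 4, 4]
  else if e = 49 then [6, 5, 5, 4]
  else if e = 50 then [5, 5, 5, 5]
  else if e = 51 then [6, 6, 4, 3, 1]
  else if e = 52 then [6, 5, 5, 3, 1]
  else if e = 53 then [6, 5, 4, 4, 1]
  else if e = 54 then [5, 5, 5, 4, 1]
  else if e = 55 then [6, 5, 4, 3, 2]
  else if e = 56 then [5, 5, 5, 3, 2]
  else if e = 57 then [5, 5, 4, 4, 2]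
  else if e = 58 then [5, 5, 4, 3, 3]
  else if e = 59 then [5, 4, 4, 4, 3]
  else if e = 60 then [4, 4, 4, 4, 4]
  else if e = 61 then [5, 4, 4, 4, 2, 1]
  else if e = 62 then [5, 4, 4, 3, 3, 1]
  else if e = 63 then [4, 4, 4, 4, 3, 1]
  else if e = 64 then [4, 4, 4, 4, 2, 2]
  else if e = 65 then [4, 4, 4, 3, 3, 2]
  else if e = 66 then [4, 4, 3, 3, 3, 3]
  else if e = 67 then [4, 4, 4, 3, 2, 2, 1]
  else if e = 68 then [4, 4, 3, 3, 3, 2, 1]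
  else if e = 69 then [4, 3, 3, 3, 3, 3, 1]
  else if e = 70 then [4, 3, 3, 3, 3, 2, 2]
  else if e = 71 then [3, 3, 3, 3, 3, 3, 2]
  else if e = 72 then [3, 3, 3, 3, 3, 3, 1, 1]
  else if e = 73 then [3, 3, 3, 3, 3, 2, 2, 1]
  else if e = 74 then [3, 3, 3, 3, 2, 2, 2, 2]
  else if e = 75 then [3, 3, 3, 3, 2, 2, 2, 1, 1]
  else if e = 76 then [3, 3, 3, 2, 2, 2, 2, 2, 1]
  else if e = 77 then [3, 3, 2, 2, 2, 2, 2, 2, 2]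
  else if e = 78 then [3, 3, 2, 2, 2, 2, 2, 2, 1, 1]
  else if e = 79 then [3, 2, 2, 2, 2, 2, 2, 2, 2, 1]
  else if e = 80 then [2, 2, 2, 2, 2, 2, 2, 2, 2, 2]
  else if e = 81 then [2, 2, 2, 2, 2, 2, 2, 2, 2, 1, 1]
  else if e = 82 then [2, 2, 2, 2, 2, 2, 2, 2, 1, 1, 1, 1]
  else if e = 83 then [2, 2, 2, 2, 2, 2, 2, 1, 1, 1, 1, 1, 1]
  else if e = 84 then [2, 2, 2, 2, 2, 2, 1, 1, 1, 1, 1, 1, 1, 1]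
  else if e = 85 then [2, 2, 2, 2, 2, 1, 1, 1, 1, 1, 1, 1, 1, 1, 1]
  else if e = 86 then [2, 2, 2, 2, 1, 1, 1, 1, 1, 1, 1, 1, 1, 1, 1, 1]
  else if e = 87 then [2, 2, 2, 1, 1, 1, 1, 1, 1, 1, 1, 1, 1, 1, 1, 1, 1]
  else if e = 88 then [2, 2, 1, 1, 1, 1, 1, 1, 1, 1, 1, 1, 1, 1, 1, 1, 1, 1]
  else if e = 89 then [2, 1, 1, 1, 1, 1, 1, 1, 1, 1, 1, 1, 1, 1, 1, 1, 1, 1, 1]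
  else [1, 1, 1, 1, 1, 1, 1, 1, 1, 1, 1, 1, 1, 1, 1, 1, 1, 1, 1, 1]

/-- The facts about a block: entries in `[1, 10]`, sum `10` or `20`, excess `Σ k (10 − k) = 2 e`. -/
theorem blockTen_facts (e : ℕ) (he : e = 9 ∨ e = 16 ∨ e = 17 ∨ e = 18 ∨ e = 21 ∨ (23 ≤ e ∧ e ≤ 90)) :
    (∀ x ∈ blockTen e, 1 ≤ x ∧ x ≤ 10) ∧ ((blockTen e).sum = 10 ∨ (blockTen e).sum = 20) ∧
      ((blockTen e).map (fun k => k * (10 - k))).sum = 2 * e := by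
  unfold blockTen
  rcases he with rfl | rfl | rfl | rfl | rfl | ⟨he1, he2⟩
  · simp
  · simp
  · simp
  · simp
  · simp
  · interval_cases e <;> simp

/-- **THE ROWS OF EVERY EXCESS AT `ℓ = 10`:** for `m ∈ {9, 16, 17, 18, 21}` or `23 ≤ m ≤ 45 D` (`2 ≤ D`) there are row
sizes `1 ≤ k i ≤ 10`, `i < N`, with `Σ k = 10 D` and `Σ k (10 − k) = 2 m`. -/
theorem rows_of_excess_ten (D m : ℕ) (hD : 2 ≤ D) (hm : m = 9 ∨ m = 16 ∨ m = 17 ∨ m = 18 ∨ m = 21 ∨ (23 ≤ m ∧ m ≤ 45 * D)) :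
    ∃ (N : ℕ) (k : ℕ → ℕ), (∀ i, i < N → 1 ≤ k i ∧ k i ≤ 10) ∧ ∑ i ∈ range N, k i = 10 * D ∧
      ∑ i ∈ range N, k i * (10 - k i) = 2 * m := by
  obtain ⟨a, e, hae, he, haD⟩ : ∃ a e, m = 45 * a + e ∧ (e = 9 ∨ e = 16 ∨ e = 17 ∨ e = 18 ∨ e = 21 ∨ (23 ≤ e ∧ e ≤ 90)) ∧ a + 2 ≤ D := by
    rcases hm with rfl | rfl | rfl | rfl | rfl | ⟨hm1, hm2⟩
    · exact ⟨0, 9, by ring, by omega, by omega⟩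
    · exact ⟨0, 16, by ring, by omega, by omega⟩
    · exact ⟨0, 17, by ring, by omega, by omega⟩
    · exact ⟨0, 18, by ring, by omega, by omega⟩
    · exact ⟨0, 21, by ring, by omega, by omega⟩
    · refine ⟨min ((m - 23) / 45) (D - 2), m - 45 * min ((m - 23) / 45) (D - 2), by omega, ?_, by omega⟩
      right; right; right; right; right
      omega
  obtain ⟨hb1, hb2, hb5⟩ := blockTen_facts e he
  set B := blockTen e with hB
  set c := B.sum / 10 with hc
  have hc' : B.sum = 10 * c := by
    rcases hb2 with h | h <;> rw [h] at hc ⊢ <;> omega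
  have hcD : a + c ≤ D := by
    rcases hb2 with h | h <;> rw [h] at hc <;> omega
  set L := List.replicate (10 * a) 1 ++ B ++ List.replicate (D - a - c) 10 with hL
  have hLmem : ∀ x ∈ L, 1 ≤ x ∧ x ≤ 10 := by
    intro x hx
    rw [hL, List.mem_append, List.mem_append, List.mem_replicate, List.mem_replicate] at hx
    rcases hx with (hx | hx) | hx
    · omega
    · exact hb1 x hx
    · omega
  refine ⟨L.length, fun i => L.getD i 0, fun i hi => getD_bounds_ten L hLmem i hi, ?_, ?_⟩
  · rw [sum_range_getD L (fun x => x), hL, List.map_append, List.map_append, List.sum_append, List.sum_append,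
      List.map_id', List.map_id', List.map_id', List.sum_replicate, List.sum_replicate, hc']
    simp only [smul_eq_mul]
    omega
  · rw [sum_range_getD L (fun k => k * (10 - k)), hL, List.map_append, List.map_append, List.sum_append,
      List.sum_append, List.map_replicate, List.map_replicate, List.sum_replicate, List.sum_replicate, hb5]
    simp only [smul_eq_mul]
    omega

/-- The excess of a row is at most nine times its size: `k (10 − k) ≤ 9 k`. -/
theorem excess_le_nine_mul (k : ℕ) : k * (10 - k) ≤ 9 * k := by
  rcases Nat.lt_or_ge k 10 with h | h
  · interval_cases k <;> omega
  · rw [Nat.sub_eq_zero_of_le h, mul_zero]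
    exact Nat.zero_le _

/-- **THE REGULAR CELL `t = 10 D`, EXACTLY:** for `10 ≤ D`, `t = 10 D`, `2 t ≤ s`, `j` is the band value of a
triangle-free graph on `11 + (s − t)` vertices with `s` edges, a vertex of degree `s − t` and every off-degree `≤ D`
IFF `j − bottomReg 10 D ∈ {0, 9, 16, 17, 18, 21} ∪ [23, 45 D]`. -/
theorem regular_cell_ten (s t D j : ℕ) (hD : 10 ≤ D) (ht : t = 10 * D) (hs : 2 * t ≤ s) :
    (∃ (H : SimpleGraph (Fin (10 + 1 + (s - t)))) (_ : DecidableRel H.Adj), H.CliqueFree 3 ∧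
      H.edgeFinset.card = s ∧ ∃ w, deg H w + t = s ∧ (∀ v, offDeg H w v ≤ D) ∧
        ∑ v, deg H v * deg H v + 2 * (t * (s - t - 1)) + 2 * j = s * (s + 1)) ↔
    (j = bottomReg 10 D ∨ j = bottomReg 10 D + 9 ∨ j = bottomReg 10 D + 16 ∨ j = bottomReg 10 D + 17 ∨
      j = bottomReg 10 D + 18 ∨ j = bottomReg 10 D + 21 ∨ (bottomReg 10 D + 23 ≤ j ∧ j ≤ bottomReg 10 D + 45 * D)) := by
  subst ht
  have hb := two_mul_bottomReg 10 D (by norm_num) hD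
  constructor
  · intro hj
    obtain ⟨N, k, hk, hsum, hid⟩ := (regular_cell_iff s (10 * D) 10 D j (by norm_num) hD rfl hs).mp hj
    have hup : ∑ i ∈ range N, k i * (10 - k i) ≤ 90 * D := by
      calc ∑ i ∈ range N, k i * (10 - k i) ≤ ∑ i ∈ range N, 9 * k i := sum_le_sum (fun i _ => excess_le_nine_mul (k i))
        _ = 9 * ∑ i ∈ range N, k i := by rw [mul_sum]
        _ = 90 * D := by rw [hsum]; ring
    have h19 := no_nineteen_ten D k N hk hsum
    have h20 := no_twenty_ten D k N hk hsum
    have h22 := no_twentytwo_ten D k N hk hsum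
    rcases row_excess_trichotomy 10 D k N (by norm_num) (fun m hm => (hk m hm).1) (fun m hm => (hk m hm).2) hsum
      with h0 | h1 | h2
    · left
      omega
    · right; left
      omega
    · omega
  · intro hj
    have hval : ∀ m, (m = 9 ∨ m = 16 ∨ m = 17 ∨ m = 18 ∨ m = 21 ∨ (23 ≤ m ∧ m ≤ 45 * D)) →
        (∃ (H : SimpleGraph (Fin (10 + 1 + (s - 10 * D)))) (_ : DecidableRel H.Adj), H.CliqueFree 3 ∧
          H.edgeFinset.card = s ∧ ∃ w, deg H w + 10 * D = s ∧ (∀ v, offDeg H w v ≤ D) ∧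
            ∑ v, deg H v * deg H v + 2 * (10 * D * (s - 10 * D - 1)) + 2 * (bottomReg 10 D + m) = s * (s + 1)) := by
      intro m hm
      apply (regular_cell_iff s (10 * D) 10 D _ (by norm_num) hD rfl hs).mpr
      obtain ⟨N, k, hk, hsum, hex⟩ := rows_of_excess_ten D m (by omega) hm
      refine ⟨N, k, hk, hsum, ?_⟩
      rw [hex]
      omega
    rcases hj with rfl | rfl | rfl | rfl | rfl | rfl | ⟨hlo, hhi⟩
    · exact ((regular_cell_first_gap s (10 * D) 10 D (by norm_num) hD rfl hs).2.1)
    · exact hval 9 (by omega)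
    · exact hval 16 (by omega)
    · exact hval 17 (by omega)
    · exact hval 18 (by omega)
    · exact hval 21 (by omega)
    · have := hval (j - bottomReg 10 D) (by omega)
      rwa [Nat.add_sub_cancel' (by omega : bottomReg 10 D ≤ j)] at this

end C047

end TriangleCap

end PercRepro
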